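import Summits.FinalStateConjecture.FinalStateConjecture.Theses.ExactKerrEnds
import Literature.Geometry.Lorentzian.ExactKerrEnd
import Literature.Geometry.Lorentzian.TameGenericityDiagonal

/-! # Sketch — first lemmas of the crux ideas (crux-ideate k=2, round 1) for
`ExactKerrEnds.SettlingAlongCensoredKerrEnds` (stmt-FinalStateConjecture-18520).

Card `one-sided-sections` (flat / linear amplitude sections of a kick unfolding riding the input
curve) and card `interpolation-seam` (regularity budget of Kerr-ended data: C⁰ → C³ off the horizon
is Gagliardo–Nirenberg; the honest remainder of the upgrade is a red-shift layer lemma).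
Signatures only (sorried); they must elaborate. -/

noncomputable section
set_option linter.dupNamespace false
open Set Function Filter Topology
open scoped Manifold ContDiff ENNReal
open Literature.Geometry.Lorentzian

namespace Summit.FinalStateConjecture.FinalStateConjecture.Cruxes.SettlingAlongCensoredKerrEnds.IdeasK2

variable {X : Type} [TopologicalSpace X] [ChartedSpace E3 X] [IsManifold (𝓡 3) ∞ X] [T2Space X]
  [SecondCountableTopology X] [ConnectedSpace X]

/-! ### Card `one-sided-sections` -/

/-- The point `(t, s)` of the parameter plane `ℝ²`. -/
def pt (t s : ℝ) : EuclideanSpace ℝ (Fin 2) :=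
  t • EuclideanSpace.single 0 (1 : ℝ) + s • EuclideanSpace.single 1 (1 : ℝ)

/-- **FIRST LEMMA (a) — smooth flat minorants.** Below every positive function on `ℝ ∖ {0}` that
is locally bounded below there is a smooth positive function, flat (all derivatives zero) at `0`.
Pure real analysis (dyadic partition of unity); it is what lets a kick amplitude die faster than
any degeneration of the kick chart / of the settled ceiling as the members approach the arbitrary
base datum `F 0`. M-sized. -/
theorem exists_smooth_flat_minorant (q : ℝ → ℝ) (hq : ∀ c ≠ 0, 0 < q c)
    (hloc : ∀ c ≠ 0, ∃ ε > (0 : ℝ), ∀ᶠ c' in 𝓝 c, ε ≤ q c') :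
    ∃ s : ℝ → ℝ, ContDiff ℝ ∞ s ∧ s 0 = 0 ∧ (∀ n, iteratedDeriv n s 0 = 0) ∧
      ∀ c ≠ 0, 0 < s c ∧ s c < q c := by
  sorry

/-- **FIRST LEMMA (b) — a section of a tame kick-unfolding riding the input curve is a tame curve
through the same base datum, immersed as soon as the input curve is** (the amplitude `s` has
`s 0 = 0`, `s' 0 = 0`; e.g. `s` flat, or `s t = K t²`). `G (t, s)` = the member `F t` kicked with
amplitude `s` (`G (t, 0) = F t`). Tameness is `IsTameDataFamily.comp_contDiff` (landed) along
`t ↦ (t, s t)`; immersion is the chain rule: `d/dt G (t, s t) |₀ = ∂ₜ G (0,0) = F' (0)`. M-sized,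
provable now. (Injectivity is a separate generic-choice / gauge-shear device, not claimed here.) -/
theorem section_of_unfolding (e : AFEnd X) (F : EuclideanSpace ℝ (Fin 1) → InitialDataSet (𝓡 3) X)
    (G : EuclideanSpace ℝ (Fin 2) → InitialDataSet (𝓡 3) X) (s : ℝ → ℝ)
    (hG : InitialDataSet.IsTameDataFamily e 2 G)
    (hGF : ∀ c : EuclideanSpace ℝ (Fin 1), G (pt (c 0) 0) = F c)
    (hs : ContDiff ℝ ∞ s) (hs0 : s 0 = 0) (hs1 : deriv s 0 = 0) :
    InitialDataSet.IsTameDataFamily e 1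
        (fun c : EuclideanSpace ℝ (Fin 1) ↦ G (pt (c 0) (s (c 0)))) ∧
      (fun c : EuclideanSpace ℝ (Fin 1) ↦ G (pt (c 0) (s (c 0)))) 0 = F 0 ∧
      (InitialDataSet.IsImmersedAtZero 1 F →
        InitialDataSet.IsImmersedAtZero 1
          (fun c : EuclideanSpace ℝ (Fin 1) ↦ G (pt (c 0) (s (c 0))))) := by
  sorry

/-- The settling clause of the Statement for EVERY maximal development of `D` (verbatim the crux's
let-bound legend `Settled`). -/
def Settled {X : Type} [TopologicalSpace X] [ChartedSpace E3 X] [IsManifold (𝓡 3) ∞ X]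
    [ConnectedSpace X] (D : InitialDataSet (𝓡 3) X) : Prop :=
  ∀ 𝒟 : VacuumCauchyDevelopment D, 𝒟.IsMaximal →
    Summit.FinalStateConjecture.HasCompleteNullInfinity 𝒟.toCauchyDevelopment ∧
      ∃ (O : Set 𝒟.carrier) (d : FinalStateDecomposition 𝒟.toSpacetime O 2),
        (∀ i, Kerr.IsSubextremal (d.mass i) (d.spin i)) ∧
          O = Summit.FinalStateConjecture.exteriorOf 𝒟.toCauchyDevelopment d.charted ∧
            Summit.FinalStateConjecture.RaysStayInClosure 𝒟.toCauchyDevelopment O ∧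
              Summit.FinalStateConjecture.HasExhaustiveCharts d ∧
                Summit.FinalStateConjecture.IsFutureOriented d

/-- **The reduction the card proposes (typed): `SettledWindow`** — along every tame, INJECTIVE, IMMERSED
curve `F` of admissible data with Kerr-ended censored members off `0` there are a tame two-parameter
admissible KICK UNFOLDING `G` of `F` on some end (`G (t, 0) = F t`) and a smooth amplitude `s` with
`s 0 = 0` whose graph lies in the settled window off `0`: `Settled (G (t, s t))` for all `t ≠ 0`, and
whose section `t ↦ G (t, s t)` is injective and immersed at `0` (for `s' 0 = 0` — flat or quadratic
amplitudes — immersion is inherited from `F`, `section_of_unfolding`; on a transversal crossing at `t = 0`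
one needs `s' 0 = ` the threshold slope, and immersion is the generic non-cancellation). The CONSTANT case
of the crux is reduced to this one by replacing the constant curve through a censored Kerr-ended datum by
its breathing curve (tame, injective, immersed, members isometric — `exists_tame_selfWitness`,
`HasExactKerrEnd.comap_diffeomorph`, censorship transport; `ConstantToImmersed` below). The content splits
(crux-plan) into: pointwise one-sided settled kicks at censored KE members (capture below the extremal
threshold, uniform in the surface gravity — arXiv:2603.10378 Thm 1 shape; openness of the sub-extremal
settled basin — Hintz arXiv:2606.28253 Thm 1.1 is posed on exactly this data class), and SMOOTHNESS OF
THE THRESHOLD AMPLITUDE `S*(t)` along the family (arXiv:2603.10378 Thm 2 gives C¹; Question 1 ibid. asks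
for Cᵏ) — the forced-crossing lemma of the card shows that no member-wise construction can do without
the last one. -/
def SettledWindow : Prop :=
  ∀ (X : Type) [TopologicalSpace X] [ChartedSpace E3 X] [IsManifold (𝓡 3) ∞ X] [T2Space X]
    [SecondCountableTopology X] [ConnectedSpace X],
    ∀ (e : AFEnd X) (F : EuclideanSpace ℝ (Fin 1) → InitialDataSet (𝓡 3) X),
      InitialDataSet.IsTameDataFamily e 1 F → InitialDataSet.IsImmersedAtZero 1 F → Injective F →
          (∀ c, F c ∈ admissibleVacuumData X) →
            (∀ c ≠ 0, (F c).HasExactKerrEnd ∧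
              ∀ 𝒟 : VacuumCauchyDevelopment (F c), 𝒟.IsMaximal →
                Summit.FinalStateConjecture.HasCompleteNullInfinity 𝒟.toCauchyDevelopment) →
              ∃ (e' : AFEnd X) (G : EuclideanSpace ℝ (Fin 2) → InitialDataSet (𝓡 3) X) (s : ℝ → ℝ),
                InitialDataSet.IsTameDataFamily e' 2 G ∧
                  (∀ c : EuclideanSpace ℝ (Fin 1), G (pt (c 0) 0) = F c) ∧
                  (∀ p, G p ∈ admissibleVacuumData X) ∧ ContDiff ℝ ∞ s ∧ s 0 = 0 ∧
                  (∀ t ≠ 0, Settled (G (pt t (s t)))) ∧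
                  Injective (fun c : EuclideanSpace ℝ (Fin 1) ↦ G (pt (c 0) (s (c 0)))) ∧
                  InitialDataSet.IsImmersedAtZero 1
                    (fun c : EuclideanSpace ℝ (Fin 1) ↦ G (pt (c 0) (s (c 0))))

/-- **`ConstantToImmersed`** (bookkeeping, M): through every admissible datum all of whose members… —
precisely: through every censored Kerr-ended admissible datum `d` (handed with one tame constant curve,
i.e. a sole DR end) passes a tame, injective, immersed curve of admissible data ALL of whose members are
Kerr-ended and censored (the breathing curve of `d`: isometric copies agreeing off a compact set). With it
the constant case of the crux is an instance of the immersed case. -/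
def ConstantToImmersed : Prop :=
  ∀ (X : Type) [TopologicalSpace X] [ChartedSpace E3 X] [IsManifold (𝓡 3) ∞ X] [T2Space X]
    [SecondCountableTopology X] [ConnectedSpace X] (e : AFEnd X) (d : InitialDataSet (𝓡 3) X),
    InitialDataSet.IsTameDataFamily e 1 (fun _ : EuclideanSpace ℝ (Fin 1) ↦ d) →
      d ∈ admissibleVacuumData X → d.HasExactKerrEnd →
        (∀ 𝒟 : VacuumCauchyDevelopment d, 𝒟.IsMaximal →
          Summit.FinalStateConjecture.HasCompleteNullInfinity 𝒟.toCauchyDevelopment) →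
          ∃ (e' : AFEnd X) (B : EuclideanSpace ℝ (Fin 1) → InitialDataSet (𝓡 3) X),
            InitialDataSet.IsTameDataFamily e' 1 B ∧ B 0 = d ∧ Injective B ∧
              InitialDataSet.IsImmersedAtZero 1 B ∧ (∀ c, B c ∈ admissibleVacuumData X) ∧
              ∀ c, (B c).HasExactKerrEnd ∧
                ∀ 𝒟 : VacuumCauchyDevelopment (B c), 𝒟.IsMaximal →
                  Summit.FinalStateConjecture.HasCompleteNullInfinity 𝒟.toCauchyDevelopment

/-- **Sanity composition (PROVED): the crux from `SettledWindow` and `ConstantToImmersed`.**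
Immersed-injective input: take the section of the unfolding handed by `SettledWindow`
(tame by `IsTameDataFamily.comp_contDiff`, settled off `0` because `c ≠ 0 ↔ c 0 ≠ 0` on `ℝ¹`).
Constant input: breathe first (`ConstantToImmersed`), then the same. Certifies the typing of the
card's target against the crux BY NAME. -/
theorem settlingAlongCensoredKerrEnds_of_settledWindow (hW : SettledWindow) (hC : ConstantToImmersed) :
    Summit.FinalStateConjecture.FinalStateConjecture.Theses.ExactKerrEnds.SettlingAlongCensoredKerrEnds := by
  intro X _ _ _ _ _ _ KerrEnded Censored Settled' e F hF hdich h𝓓 hQ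
  -- members off `0`: Kerr-ended in `HasExactKerrEnd` form, and censored
  have hQ' : ∀ c ≠ 0, (F c).HasExactKerrEnd ∧
      ∀ 𝒟 : VacuumCauchyDevelopment (F c), 𝒟.IsMaximal →
        Summit.FinalStateConjecture.HasCompleteNullInfinity 𝒟.toCauchyDevelopment := fun c hc ↦
    ⟨(InitialDataSet.hasExactKerrEnd_iff (F c)).2 (hQ c hc).1, (hQ c hc).2⟩
  -- the immersed-injective case as a reusable claim
  have key : ∀ (e₁ : AFEnd X) (F₁ : EuclideanSpace ℝ (Fin 1) → InitialDataSet (𝓡 3) X),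
      InitialDataSet.IsTameDataFamily e₁ 1 F₁ → InitialDataSet.IsImmersedAtZero 1 F₁ → Injective F₁ →
        (∀ c, F₁ c ∈ admissibleVacuumData X) →
          (∀ c ≠ 0, (F₁ c).HasExactKerrEnd ∧
            ∀ 𝒟 : VacuumCauchyDevelopment (F₁ c), 𝒟.IsMaximal →
              Summit.FinalStateConjecture.HasCompleteNullInfinity 𝒟.toCauchyDevelopment) →
            ∃ (e' : AFEnd X) (F' : EuclideanSpace ℝ (Fin 1) → InitialDataSet (𝓡 3) X),
              InitialDataSet.IsTameDataFamily e' 1 F' ∧ F' 0 = F₁ 0 ∧ Injective F' ∧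
                InitialDataSet.IsImmersedAtZero 1 F' ∧ (∀ c, F' c ∈ admissibleVacuumData X) ∧
                ∀ c ≠ 0, Settled (F' c) := by
    intro e₁ F₁ hF₁ hI hinj h𝓓₁ hQ₁
    obtain ⟨e', G, s, hG, hGF, hGadm, hs, hs0, hgood, hinjS, himmS⟩ := hW X e₁ F₁ hF₁ hI hinj h𝓓₁ hQ₁
    have h0 : ContDiff ℝ ∞ (fun c : EuclideanSpace ℝ (Fin 1) ↦ c 0) :=
      (EuclideanSpace.proj (0 : Fin 1) : EuclideanSpace ℝ (Fin 1) →L[ℝ] ℝ).contDiff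
    have hφ : ContDiff ℝ ∞ (fun c : EuclideanSpace ℝ (Fin 1) ↦ pt (c 0) (s (c 0))) :=
      (h0.smul contDiff_const).add ((hs.comp h0).smul contDiff_const)
    have hφ0 : (fun c : EuclideanSpace ℝ (Fin 1) ↦ pt (c 0) (s (c 0))) 0 = 0 := by
      simp [pt, hs0]
    refine ⟨e', fun c ↦ G (pt (c 0) (s (c 0))), hG.comp_contDiff hφ hφ0, ?_, hinjS, himmS,
      fun c ↦ hGadm _, fun c hc ↦ ?_⟩
    · simpa [hs0] using hGF 0
    · have hc0 : c 0 ≠ 0 := by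
        intro h
        apply hc
        ext i
        rw [Subsingleton.elim i 0, h]
        rfl
      exact hgood (c 0) hc0
  rcases hdich with ⟨hI, hinj⟩ | hconst
  · exact key e F hF hI hinj h𝓓 hQ'
  · -- constant input: breathe first
    have hFeq : F = fun _ ↦ F 0 := funext hconst
    have hconstTame : InitialDataSet.IsTameDataFamily e 1
        (fun _ : EuclideanSpace ℝ (Fin 1) ↦ F 0) := hFeq ▸ hF
    set c₁ : EuclideanSpace ℝ (Fin 1) := EuclideanSpace.single 0 1 with hc₁
    have c₁ne : c₁ ≠ 0 := by
      intro h
      have := congrArg (fun v : EuclideanSpace ℝ (Fin 1) ↦ v 0) h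
      simp [hc₁] at this
    have hKE : (F 0).HasExactKerrEnd := hconst c₁ ▸ (hQ' c₁ c₁ne).1
    have hCen : ∀ 𝒟 : VacuumCauchyDevelopment (F 0), 𝒟.IsMaximal →
        Summit.FinalStateConjecture.HasCompleteNullInfinity 𝒟.toCauchyDevelopment :=
      hconst c₁ ▸ (hQ' c₁ c₁ne).2
    obtain ⟨e₁, B, hB, hB0, hBinj, hBimm, hBadm, hBgood⟩ :=
      hC X e (F 0) hconstTame (h𝓓 0) hKE hCen
    obtain ⟨e', F', h1, h2, h3, h4, h5, h6⟩ := key e₁ B hB hBimm hBinj hBadm (fun c _ ↦ hBgood c)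
    exact ⟨e', F', h1, h2.trans hB0, h3, h4, h5, h6⟩

/-! ### Card `interpolation-seam` -/

/-- **FIRST LEMMA — Gagliardo–Nirenberg on Kerr–Schild windows.** If the C⁰ deviation of a hole
chart from boosted Kerr tends to `0` on every truncated slab and its C⁴ deviation stays bounded on
the slabs of radius `R + 1`, then its C³ deviation tends to `0` on the slabs of radius `R`
(interpolate on the 4-dimensional windows `{τ-1 ≤ t* ≤ τ+1, r ≤ R+1}`, a fixed Lipschitz domain
translated in `t*`: `‖D³f‖_∞ ≲ ‖f‖_∞^{1/4} ‖D⁴f‖_∞^{3/4} + ‖f‖_∞`). Pure analysis, L-sized in Lean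
(no multivariate Landau–Kolmogorov in Mathlib yet). On Kerr-ended data the C⁴ budget is available
(smooth data, compactly supported deviation, no incoming focusing trains — contrast
`StationaryLimitReduction/Negative/FarFieldFocusing` over the whole admissible class). -/
theorem truncDeviation_interpolation {𝓢 : Spacetime.{0} 4} (Λ : lorentzGroup) (c₀ : E4) (M a : ℝ)
    (Ψ : (boostedKerrBackground Λ c₀ M a).domain → 𝓢.carrier) (R : ℝ) (C : ℝ≥0∞) (hC : C ≠ ⊤)
    (h0 : ∀ R' : ℝ, Tendsto (fun τ ↦ 𝓢.truncDeviationCk (boostedKerrBackground Λ c₀ M a) Ψ 0 R' τ)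
      atTop (𝓝 0))
    (h4 : ∀ᶠ τ in atTop, 𝓢.truncDeviationCk (boostedKerrBackground Λ c₀ M a) Ψ 4 (R + 1) τ ≤ C) :
    Tendsto (fun τ ↦ 𝓢.truncDeviationCk (boostedKerrBackground Λ c₀ M a) Ψ 3 R τ) atTop (𝓝 0) := by
  sorry

/-- **The re-cut the card proposes (typed, hole side only): off-horizon regularity budget as part
of capture.** `OffHorizonBudget d₀` for a C⁰ decomposition: for every hole `i`, every `δ > 0` and
every `R` the C⁴ deviation on the δ-RETRACTED truncated slabs `{t*ᵢ = τ, r₊ + δ ≤ rᵢ ≤ R}` is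
eventually bounded (consistent with extremal members: Aretakis growth is confined to the horizon).
Stated with `supCkENorm` over the retracted slab. -/
def OffHorizonBudget {𝓢 : Spacetime.{0} 4} {O : Set 𝓢.carrier}
    (d₀ : FinalStateDecomposition 𝓢 O 0) : Prop :=
  ∀ (i : Fin d₀.N) (δ R : ℝ), 0 < δ →
    ∃ C : ℝ≥0∞, C ≠ ⊤ ∧ ∀ᶠ τ in atTop,
      supCkENorm (Subtype.val '' {x : (d₀.background i).domain |
          (d₀.background i).time x.1 = τ ∧ (d₀.background i).radius x.1 ≤ R ∧
            Kerr.rPlus (d₀.mass i) (d₀.spin i) + δ ≤ (d₀.background i).radius x.1}) 4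
        (𝓢.deviationExtend (d₀.background i) (d₀.chart i)) ≤ C

end Summit.FinalStateConjecture.FinalStateConjecture.Cruxes.SettlingAlongCensoredKerrEnds.IdeasK2
end
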